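import Literature.AlgebraicGeometry.Morphisms.CechH2FibreDimOneProjective
import HarnessLib

/-!
# The (S)-step Čech gluing along `ρ : Z → B` for `B` PROJECTIVE over a local ring with closed fibre of
# dimension `≤ 1` — fact-free twins of `CechH1PreimageGluing` §4

Topic: `Literature/AlgebraicGeometry/Morphisms`. Fact-free cochain algebra: the §3 Piece core
`cechRefineH1_piece_surjective` / `length_cechH1_piece_le` of `Morphisms/CechH1PreimageGluing` (Görtz–Wedhorn II
Cor. 21.82) composed with the PROJECTIVE (H2V) input `cechZ2_exact_preimageFamily_of_isProjectiveOverRing` of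
`Morphisms/CechH2FibreDimOneProjective` (the projective case of Görtz–Wedhorn II Cor. 24.44, PROVED there) —
i.e. the three §4 theorems `cechRefineH1_preimage_piece_surjective_of_GW`, `length_cechH1_preimage_piece_le_of_GW`,
`cechRefineH1_preimage_piece_surjective_of_GW'` with the named-fact hypothesis `(hGW : GortzWedhorn2023_24_44_H2)`
REPLACED by projectivity of `g : B → Spec A` (`Crystalline.IsProjectiveOverRing (Over.mk g)`) and the fibre bound read
at the closed point only.  No Noetherian hypothesis on `A` and no finiteness of the index types are needed in this form.
Consumer: the W4.4 kill-test line's chart lemma (`…SurfaceTerminationGenusChart.lean`, leaf L3 of the desk census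
`F53-CONSUMER-CENSUS-v0.md`), whose middle model is a blow-up, projective by `Resolution.affineBlowup.isProjectiveOverRing`.
[OURS plumbing for cell res-hironaka, crux chain W4.4; prover res-inputs-p-6 on critic REFEREE R21 (2) / desk GO.]
NOT a statement of any manuscript under review (Hironaka 2017).  AI-written; weaker than expert review.

## References
* U. Görtz, T. Wedhorn, *Algebraic Geometry II* (2023), Cor. 21.82 (p. 265), Cor. 24.44. [GortzWedhorn2023]
-/

noncomputable section

open CategoryTheory AlgebraicGeometry TopologicalSpace IsLocalRing

universe u v

namespace Literature.AlgebraicGeometry.Morphisms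

section Preimage

variable {A : Type u} [CommRing A] [IsLocalRing A] {B Z : Scheme.{u}}

/-- **The (S)-step surjection over a PROJECTIVE `B`** (fact-free twin of
`cechRefineH1_preimage_piece_surjective_of_GW`): `g : B → Spec A` projective over the local ring `A` with
`dim B_𝔪 ≤ 1`; `ρ : Z → B` with `Z` Noetherian, `f = ρ ≫ g`; `𝒲` a family of affine opens covering `B`; `𝒰` an open
cover of `Z` refining `(ρ⁻¹W_a)_a`; `a₀` an index such that every mixed piece has
`Ȟ¹((U_i ∩ ρ⁻¹W_{a₀} ∩ ρ⁻¹W_b)_i, 𝒪_Z) = 0` (`b ≠ a₀`).  Then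
`Ȟ¹(𝒰, 𝒪_Z) → Ȟ¹((U_i ∩ ρ⁻¹W_{a₀})_i, 𝒪_Z)` is surjective.
[cite: GortzWedhorn2023, Cor. 21.82 (p. 265), Cor. 24.44 (projective case)] -/
theorem cechRefineH1_preimage_piece_surjective_of_isProjectiveOverRing (g : B ⟶ Spec (.of A))
    (hg : Crystalline.IsProjectiveOverRing (Over.mk g : Motives.SchemeOver A))
    (hfib : topologicalKrullDim (g.fiber (closedPoint A)) ≤ 1)
    (ρ : Z ⟶ B) [NoetherianSpace Z] (f : Z ⟶ Spec (.of A)) (hf : ρ ≫ g = f)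
    {α : Type u} (W : α → B.Opens) (hW : ∀ a, IsAffineOpen (W a)) (hcov : ⨆ a, W a = ⊤)
    {ι : Type v} (U : ι → Z.Opens) (r : ι → α) (hr : ∀ i, U i ≤ ρ ⁻¹ᵁ W (r i)) (hU : ⨆ i, U i = ⊤)
    (a₀ : α)
    (hvan : ∀ b, b ≠ a₀ →
      cechZ1 f (fun i => U i ⊓ ρ ⁻¹ᵁ W a₀ ⊓ ρ ⁻¹ᵁ W b) ≤
        cechB1 f (fun i => U i ⊓ ρ ⁻¹ᵁ W a₀ ⊓ ρ ⁻¹ᵁ W b)) :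
    Function.Surjective
      (cechRefineH1 f U (fun i => U i ⊓ ρ ⁻¹ᵁ W a₀) id (fun _ => inf_le_left)) :=
  cechRefineH1_piece_surjective f U (preimageFamily ρ W) r hr hU
    (cechZ2_exact_preimageFamily_of_isProjectiveOverRing g hg hfib ρ f hf W hW hcov) a₀ hvan

/-- **The (S)-step length inequality over a PROJECTIVE `B`** (fact-free twin of
`length_cechH1_preimage_piece_le_of_GW`): under the same hypotheses,
`length_A Ȟ¹((U_i ∩ ρ⁻¹W_{a₀})_i, 𝒪_Z) ≤ length_A Ȟ¹(𝒰, 𝒪_Z)`.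
[cite: GortzWedhorn2023, Cor. 21.82 (p. 265), Cor. 24.44 (projective case)] -/
theorem length_cechH1_preimage_piece_le_of_isProjectiveOverRing (g : B ⟶ Spec (.of A))
    (hg : Crystalline.IsProjectiveOverRing (Over.mk g : Motives.SchemeOver A))
    (hfib : topologicalKrullDim (g.fiber (closedPoint A)) ≤ 1)
    (ρ : Z ⟶ B) [NoetherianSpace Z] (f : Z ⟶ Spec (.of A)) (hf : ρ ≫ g = f)
    {α : Type u} (W : α → B.Opens) (hW : ∀ a, IsAffineOpen (W a)) (hcov : ⨆ a, W a = ⊤)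
    {ι : Type v} (U : ι → Z.Opens) (r : ι → α) (hr : ∀ i, U i ≤ ρ ⁻¹ᵁ W (r i)) (hU : ⨆ i, U i = ⊤)
    (a₀ : α)
    (hvan : ∀ b, b ≠ a₀ →
      cechZ1 f (fun i => U i ⊓ ρ ⁻¹ᵁ W a₀ ⊓ ρ ⁻¹ᵁ W b) ≤
        cechB1 f (fun i => U i ⊓ ρ ⁻¹ᵁ W a₀ ⊓ ρ ⁻¹ᵁ W b)) :
    Module.length A (CechH1 f (fun i => U i ⊓ ρ ⁻¹ᵁ W a₀)) ≤ Module.length A (CechH1 f U) :=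
  Module.length_le_of_surjective _
    (cechRefineH1_preimage_piece_surjective_of_isProjectiveOverRing g hg hfib ρ f hf W hW hcov U r hr
      hU a₀ hvan)

/-- **The (S)-step over a PROJECTIVE `B`, with the mixed pieces written as preimages of the affine overlaps
`W_{a₀} ∩ W_b`** (fact-free twin of `cechRefineH1_preimage_piece_surjective_of_GW'`): if
`Ȟ¹((U_i ∩ ρ⁻¹(W_{a₀} ∩ W_b))_i, 𝒪_Z) = 0` for all `b ≠ a₀`, then
`Ȟ¹(𝒰, 𝒪_Z) ↠ Ȟ¹((U_i ∩ ρ⁻¹W_{a₀})_i, 𝒪_Z)` and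
`length_A Ȟ¹((U_i ∩ ρ⁻¹W_{a₀})_i, 𝒪_Z) ≤ length_A Ȟ¹(𝒰, 𝒪_Z)`.
[cite: GortzWedhorn2023, Cor. 21.82 (p. 265), Cor. 24.44 (projective case)] -/
theorem cechRefineH1_preimage_piece_surjective_of_isProjectiveOverRing' (g : B ⟶ Spec (.of A))
    (hg : Crystalline.IsProjectiveOverRing (Over.mk g : Motives.SchemeOver A))
    (hfib : topologicalKrullDim (g.fiber (closedPoint A)) ≤ 1)
    (ρ : Z ⟶ B) [NoetherianSpace Z] (f : Z ⟶ Spec (.of A)) (hf : ρ ≫ g = f)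
    {α : Type u} (W : α → B.Opens) (hW : ∀ a, IsAffineOpen (W a)) (hcov : ⨆ a, W a = ⊤)
    {ι : Type v} (U : ι → Z.Opens) (r : ι → α) (hr : ∀ i, U i ≤ ρ ⁻¹ᵁ W (r i)) (hU : ⨆ i, U i = ⊤)
    (a₀ : α)
    (hvan : ∀ b, b ≠ a₀ →
      cechZ1 f (fun i => U i ⊓ ρ ⁻¹ᵁ (W a₀ ⊓ W b)) ≤ cechB1 f (fun i => U i ⊓ ρ ⁻¹ᵁ (W a₀ ⊓ W b))) :
    Function.Surjective
        (cechRefineH1 f U (fun i => U i ⊓ ρ ⁻¹ᵁ W a₀) id (fun _ => inf_le_left)) ∧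
      Module.length A (CechH1 f (fun i => U i ⊓ ρ ⁻¹ᵁ W a₀)) ≤ Module.length A (CechH1 f U) := by
  have hvan' : ∀ b, b ≠ a₀ →
      cechZ1 f (fun i => U i ⊓ ρ ⁻¹ᵁ W a₀ ⊓ ρ ⁻¹ᵁ W b) ≤
        cechB1 f (fun i => U i ⊓ ρ ⁻¹ᵁ W a₀ ⊓ ρ ⁻¹ᵁ W b) := fun b hb =>
    cechZ1_le_cechB1_of_eq f (funext fun i => inf_assoc (U i) (ρ ⁻¹ᵁ W a₀) (ρ ⁻¹ᵁ W b)) (hvan b hb)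
  exact ⟨cechRefineH1_preimage_piece_surjective_of_isProjectiveOverRing g hg hfib ρ f hf W hW hcov U r hr
      hU a₀ hvan',
    length_cechH1_preimage_piece_le_of_isProjectiveOverRing g hg hfib ρ f hf W hW hcov U r hr hU a₀ hvan'⟩

end Preimage

end Literature.AlgebraicGeometry.Morphisms

end
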